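import Mathlib
import Summits.AnomalousDissipation.AnomalousDissipation.Theorems.DyadicWallCascadeViscousContinuationStubNoFastBlowDownHarmonicScalingTools
import HarnessLib

/-!
# A harmonic hierarchy has zero energy flux (endgame of the rate obstruction `NoFastBlowDown`)

Crux `Summit.AnomalousDissipation.AnomalousDissipation.Theses.DyadicWallCascade.ViscousContinuation`
(stmt-AnomalousDissipation-17917, line SketchIdeator4, lead c1).

**Theorem** (`noFastBlowDown_harmonic_flux_zero`).  Let `U : ℝ³ → ℝ³` be smooth, with
`U (2X) = U X` for `1/2 ≤ X₂ ≤ 1`, `1`-periodic in `X₀, X₁` on the band `1 ≤ X₂ ≤ 2`, and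
HARMONIC on the open slab `1/2 < X₂ < 2` (`Σᵢ ∂ᵢ∂ᵢ U = 0`, as the crux writes Laplacians).  If the
mass flux of `U` through the unit square of the plane `X₂ = 1` vanishes, then so does the energy
flux `∫ U₂ (‖U‖²/2 + Q)` through it, for every `Q`.

This replaces the unique-continuation endgame of the paper proof of the rate obstruction
(Cruxes/ViscousContinuation/Disproof.lean §5, `not_viscousWallProfileFastBlowDown`) by one-variable
calculus.  With `ρ = k ⊗ k` (`k` the two-cell partition of unity of `noFastBlowDown_cell_profile`)
put `g(z) = ∫ρ ‖U‖²/2`, `φ(z) = ∫ρ ⟪U, ∂₂U⟫`, `e(z) = ∫ρ (‖∂₂U‖² + ‖∂₀U‖² + ‖∂₁U‖²)` (cell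
averages at height `z`).  Then `g′ = φ` and `φ′ = ∫ρ (‖∂₂U‖² + ⟪U, ∂₂∂₂U⟫) = e` on the slab
(differentiation under the integral sign; the slice identity
`noFastBlowDown_harm_slice_identity`), while dilation and periodicity give `g(3/2) = g(3/4)` and
`φ(3/2) = φ(3/4)/2` (`noFastBlowDown_harm_scaling_energy/flux`).  Hence `ψ(z) = z φ(z) - g(z)` has
`ψ′ = z e(z) ≥ 0` and `ψ(3/2) = ψ(3/4)`: `ψ` is constant on `[3/4, 3/2]`, `e ≡ 0` there, so
`∇U = 0` on the open box `(0,2)² × (3/4, 3/2)`, `U` is constant there, the trace on the unit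
square of `X₂ = 1` is constant (band periodicity for the edges), its vertical component vanishes by
the mass-flux clause, and `F = 0`.  No Euler equation, no boundedness and no analyticity is used.
The file ends with the registered stub `stub_noFastBlowDownHarmonic` (the theorem itself).
-/

open MeasureTheory Set Filter Topology Function
open scoped RealInnerProductSpace

set_option linter.dupNamespace false

noncomputable section

namespace Summit.AnomalousDissipation.AnomalousDissipation.Theorems

/-- The open coordinate box `(0,2) × (0,2) × (3/4, 3/2)` of `ℝ³` is convex. [folklore] -/
theorem noFastBlowDown_harmonic_box_convex :
    Convex ℝ {X : EuclideanSpace ℝ (Fin 3) | 0 < X 0 ∧ X 0 < 2 ∧ 0 < X 1 ∧ X 1 < 2 ∧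
      3 / 4 < X 2 ∧ X 2 < 3 / 2} := by
  have hlin : ∀ i : Fin 3, IsLinearMap ℝ fun X : EuclideanSpace ℝ (Fin 3) => X i := fun i =>
    ⟨fun X Y => by simp, fun c X => by simp⟩
  have hgt : ∀ (i : Fin 3) (r : ℝ), Convex ℝ {X : EuclideanSpace ℝ (Fin 3) | r < X i} :=
    fun i r => convex_halfSpace_gt (hlin i) r
  have hlt : ∀ (i : Fin 3) (r : ℝ), Convex ℝ {X : EuclideanSpace ℝ (Fin 3) | X i < r} :=
    fun i r => convex_halfSpace_lt (hlin i) r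
  have : {X : EuclideanSpace ℝ (Fin 3) | 0 < X 0 ∧ X 0 < 2 ∧ 0 < X 1 ∧ X 1 < 2 ∧
      3 / 4 < X 2 ∧ X 2 < 3 / 2} = {X | 0 < X 0} ∩ ({X | X 0 < 2} ∩ ({X | 0 < X 1} ∩
        ({X | X 1 < 2} ∩ ({X | 3 / 4 < X 2} ∩ {X : EuclideanSpace ℝ (Fin 3) | X 2 < 3 / 2})))) := by
    ext X; simp only [mem_setOf_eq, mem_inter_iff]
  rw [this]
  exact (hgt 0 0).inter ((hlt 0 2).inter ((hgt 1 0).inter ((hlt 1 2).inter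
    ((hgt 2 _).inter (hlt 2 _)))))

/-- The open coordinate box `(0,2) × (0,2) × (3/4, 3/2)` of `ℝ³` is open. [folklore] -/
theorem noFastBlowDown_harmonic_box_isOpen :
    IsOpen {X : EuclideanSpace ℝ (Fin 3) | 0 < X 0 ∧ X 0 < 2 ∧ 0 < X 1 ∧ X 1 < 2 ∧
      3 / 4 < X 2 ∧ X 2 < 3 / 2} := by
  have hc : ∀ i : Fin 3, Continuous fun X : EuclideanSpace ℝ (Fin 3) => X i := fun i =>
    PiLp.continuous_apply 2 (fun _ : Fin 3 => ℝ) i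
  have hgt : ∀ (i : Fin 3) (r : ℝ), IsOpen {X : EuclideanSpace ℝ (Fin 3) | r < X i} :=
    fun i r => isOpen_lt continuous_const (hc i)
  have hlt : ∀ (i : Fin 3) (r : ℝ), IsOpen {X : EuclideanSpace ℝ (Fin 3) | X i < r} :=
    fun i r => isOpen_lt (hc i) continuous_const
  have : {X : EuclideanSpace ℝ (Fin 3) | 0 < X 0 ∧ X 0 < 2 ∧ 0 < X 1 ∧ X 1 < 2 ∧
      3 / 4 < X 2 ∧ X 2 < 3 / 2} = {X | 0 < X 0} ∩ ({X | X 0 < 2} ∩ ({X | 0 < X 1} ∩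
        ({X | X 1 < 2} ∩ ({X | 3 / 4 < X 2} ∩ {X : EuclideanSpace ℝ (Fin 3) | X 2 < 3 / 2})))) := by
    ext X; simp only [mem_setOf_eq, mem_inter_iff]
  rw [this]
  exact (hgt 0 0).inter ((hlt 0 2).inter ((hgt 1 0).inter ((hlt 1 2).inter
    ((hgt 2 _).inter (hlt 2 _)))))

/-- A linear map on `ℝ³` killing the three coordinate vectors is zero. [folklore] -/
theorem noFastBlowDown_harmonic_clm_eq_zero (L : EuclideanSpace ℝ (Fin 3) →L[ℝ] EuclideanSpace ℝ (Fin 3))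
    (h : ∀ i : Fin 3, L (EuclideanSpace.single i (1 : ℝ)) = 0) : L = 0 := by
  ext v j
  have hv := (EuclideanSpace.basisFun (Fin 3) ℝ).sum_repr' v
  rw [← hv, map_sum]
  simp [map_smul, h]

/-- **A harmonic hierarchy has zero energy flux.**  Let `U : ℝ³ → ℝ³` be smooth, with
`U (2X) = U X` for `1/2 ≤ X₂ ≤ 1`, `1`-periodic in `X₀, X₁` on the band `1 ≤ X₂ ≤ 2` and harmonic
(`Σᵢ ∂ᵢ∂ᵢ U = 0`) on the open slab `1/2 < X₂ < 2`.  If the mass flux through the unit square of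
`X₂ = 1` vanishes, then the energy flux `F = ∫ U₂ (‖U‖²/2 + Q)` through it vanishes, for every
`Q`.  (One-variable calculus for the cell averages `g = ∫ρ‖U‖²/2`, `φ = ∫ρ⟪U, ∂₂U⟫`:
`(z φ - g)′ = z ∫ρ |∇U|² ≥ 0` while dilation + periodicity give `(z φ - g)(3/2) = (z φ - g)(3/4)`;
hence `∇U = 0` on `(0,2)² × (3/4,3/2)`, the trace on the unit square is constant, and zero mass
flux kills its vertical component; see the module docstring.) [folklore] -/
theorem noFastBlowDown_harmonic_flux_zero
    (U : EuclideanSpace ℝ (Fin 3) → EuclideanSpace ℝ (Fin 3)) (Q : EuclideanSpace ℝ (Fin 3) → ℝ)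
    (F : ℝ) (hU : ContDiff ℝ ((⊤ : ℕ∞) : WithTop ℕ∞) U)
    (hdil : ∀ X : EuclideanSpace ℝ (Fin 3), 1 / 2 ≤ X 2 → X 2 ≤ 1 → U ((2 : ℝ) • X) = U X)
    (hper : ∀ X : EuclideanSpace ℝ (Fin 3), 1 ≤ X 2 → X 2 ≤ 2 →
      U (X + EuclideanSpace.single 0 (1 : ℝ)) = U X ∧ U (X + EuclideanSpace.single 1 (1 : ℝ)) = U X)
    (hharm : ∀ X : EuclideanSpace ℝ (Fin 3), 1 / 2 < X 2 → X 2 < 2 →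
      ∑ i : Fin 3, fderiv ℝ (fun Y => fderiv ℝ U Y (EuclideanSpace.single i (1 : ℝ))) X
        (EuclideanSpace.single i (1 : ℝ)) = 0)
    (hmass : ∫ q in Set.Icc (0 : ℝ) 1 ×ˢ Set.Icc (0 : ℝ) 1, (U !₂[q.1, q.2, (1 : ℝ)]) 2 = 0)
    (hflux : ∫ q in Set.Icc (0 : ℝ) 1 ×ˢ Set.Icc (0 : ℝ) 1,
      (U !₂[q.1, q.2, (1 : ℝ)]) 2 * (‖U !₂[q.1, q.2, (1 : ℝ)]‖ ^ 2 / 2 + Q !₂[q.1, q.2, (1 : ℝ)]) = F) :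
    F = 0 := by
  -- ### the profile and the basis vectors
  obtain ⟨k, k', -, hk, hk', hkc, hkd, hkn, hkpos, hk0, hk2, hk1, hk'0, hk'2, hk'1⟩ :=
    noFastBlowDown_cell_profile
  set e : Fin 3 → EuclideanSpace ℝ (Fin 3) := fun i => EuclideanSpace.single i (1 : ℝ) with he
  have hU1 : ContDiff ℝ 1 U := contDiff_infty.1 hU 1
  have hU2 : ContDiff ℝ 2 U := contDiff_infty.1 hU 2
  have hD : ∀ i, ContDiff ℝ ((⊤ : ℕ∞) : WithTop ℕ∞) fun Y => fderiv ℝ U Y (e i) := fun i =>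
    noFastBlowDown_weyl_contDiff_fderiv_apply hU (e i)
  have hDD : ContDiff ℝ ((⊤ : ℕ∞) : WithTop ℕ∞)
      fun Y => fderiv ℝ (fun Z => fderiv ℝ U Z (e 2)) Y (e 2) :=
    noFastBlowDown_weyl_contDiff_fderiv_apply (hD 2) (e 2)
  obtain ⟨hper12, -⟩ := noFastBlowDown_harm_periodic U hdil hper
  -- ### the four integrands
  set G1 : EuclideanSpace ℝ (Fin 3) → ℝ := fun Y => ‖U Y‖ ^ 2 / 2 with hG1
  set G2 : EuclideanSpace ℝ (Fin 3) → ℝ := fun Y => ⟪U Y, fderiv ℝ U Y (e 2)⟫ with hG2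
  set G3 : EuclideanSpace ℝ (Fin 3) → ℝ := fun Y =>
    ‖fderiv ℝ U Y (e 2)‖ ^ 2 + ⟪U Y, fderiv ℝ (fun Z => fderiv ℝ U Z (e 2)) Y (e 2)⟫ with hG3
  set G4 : EuclideanSpace ℝ (Fin 3) → ℝ := fun Y =>
    ‖fderiv ℝ U Y (e 2)‖ ^ 2 + (‖fderiv ℝ U Y (e 0)‖ ^ 2 + ‖fderiv ℝ U Y (e 1)‖ ^ 2) with hG4
  have hG1s : ContDiff ℝ 1 G1 := (hU1.norm_sq ℝ).div_const 2
  have hG2s : ContDiff ℝ 1 G2 := contDiff_infty.1 (hU.inner ℝ (hD 2)) 1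
  have hG3c : Continuous G3 :=
    (((hD 2).continuous.norm).pow 2).add (hU.continuous.inner hDD.continuous)
  have hG4c : Continuous G4 :=
    (((hD 2).continuous.norm).pow 2).add
      ((((hD 0).continuous.norm).pow 2).add (((hD 1).continuous.norm).pow 2))
  have hG4n : ∀ Y, 0 ≤ G4 Y := fun Y => by positivity
  -- ### the cell averages as functions of the height
  set g : ℝ → ℝ := fun z => ∫ q : ℝ × ℝ, k q.1 * k q.2 * G1 !₂[q.1, q.2, z] with hg
  set φ : ℝ → ℝ := fun z => ∫ q : ℝ × ℝ, k q.1 * k q.2 * G2 !₂[q.1, q.2, z] with hφ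
  set dd : ℝ → ℝ := fun z => ∫ q : ℝ × ℝ, k q.1 * k q.2 * G3 !₂[q.1, q.2, z] with hdd
  set ee : ℝ → ℝ := fun z => ∫ q : ℝ × ℝ, k q.1 * k q.2 * G4 !₂[q.1, q.2, z] with hee
  -- `g' = φ`
  have Hg : ∀ z, HasDerivAt g (φ z) z := by
    intro z
    have h := noFastBlowDown_param_hasDerivAt k G1 hk hkc hG1s z
    refine h.congr_deriv (integral_congr_ae (Eventually.of_forall fun q => ?_))
    simp only [hG1, hG2]
    rw [noFastBlowDown_fderiv_half_norm_sq U hU1]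
  -- `φ' = dd`
  have Hφ : ∀ z, HasDerivAt φ (dd z) z := by
    intro z
    have h := noFastBlowDown_param_hasDerivAt k G2 hk hkc hG2s z
    refine h.congr_deriv (integral_congr_ae (Eventually.of_forall fun q => ?_))
    simp only [hG2, hG3]
    rw [noFastBlowDown_fderiv_inner_fderiv U hU2, real_inner_self_eq_norm_sq]
  -- `dd = ee` on the slab (the slice identity)
  have Hde : ∀ z, 1 / 2 < z → z < 2 → dd z = ee z := by
    intro z hz1 hz2
    have hz : (!₂[(0 : ℝ), 0, z] : EuclideanSpace ℝ (Fin 3)) 2 = z := by simp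
    have hharmz : ∀ x y : ℝ, ∑ i : Fin 3, fderiv ℝ (fun Y => fderiv ℝ U Y (e i))
        !₂[x, y, z] (e i) = 0 := fun x y =>
      hharm _ (by simpa using hz1) (by simpa using hz2)
    have hp : ∀ x y : ℝ, U (!₂[x, y, z] + e 0) = U !₂[x, y, z] ∧
        U (!₂[x, y, z] + e 1) = U !₂[x, y, z] := fun x y =>
      hper12 _ (by simpa using hz1.le) (by simpa using hz2.le)
    have hsl := noFastBlowDown_harm_slice_identity U hU k k' hk hk' hkd hk0 hk2 hk1 hk'0 hk'2 hk'1
      z hharmz (fun x y => (hp x y).1) (fun x y => (hp x y).2)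
    have hI1 := noFastBlowDown_param_integrable k (fun Y => ‖fderiv ℝ U Y (e 2)‖ ^ 2) hk hkc
      (((hD 2).continuous.norm).pow 2) z
    have hI2 := noFastBlowDown_param_integrable k
      (fun Y => ⟪U Y, fderiv ℝ (fun Z => fderiv ℝ U Z (e 2)) Y (e 2)⟫) hk hkc
      (hU.continuous.inner hDD.continuous) z
    have hI3 := noFastBlowDown_param_integrable k
      (fun Y => ‖fderiv ℝ U Y (e 0)‖ ^ 2 + ‖fderiv ℝ U Y (e 1)‖ ^ 2) hk hkc
      ((((hD 0).continuous.norm).pow 2).add (((hD 1).continuous.norm).pow 2)) z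
    have _ := hz
    calc dd z = (∫ q : ℝ × ℝ, k q.1 * k q.2 * ‖fderiv ℝ U !₂[q.1, q.2, z] (e 2)‖ ^ 2) +
          ∫ q : ℝ × ℝ, k q.1 * k q.2 *
            ⟪U !₂[q.1, q.2, z], fderiv ℝ (fun Z => fderiv ℝ U Z (e 2)) !₂[q.1, q.2, z] (e 2)⟫ := by
          rw [← integral_add hI1 hI2]
          exact integral_congr_ae (Eventually.of_forall fun q => by simp only [hG3]; ring)
      _ = (∫ q : ℝ × ℝ, k q.1 * k q.2 * ‖fderiv ℝ U !₂[q.1, q.2, z] (e 2)‖ ^ 2) +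
          ∫ q : ℝ × ℝ, k q.1 * k q.2 *
            (‖fderiv ℝ U !₂[q.1, q.2, z] (e 0)‖ ^ 2 + ‖fderiv ℝ U !₂[q.1, q.2, z] (e 1)‖ ^ 2) := by
          rw [hsl]
      _ = ee z := by
          rw [← integral_add hI1 hI3]
          exact integral_congr_ae (Eventually.of_forall fun q => by simp only [hG4]; ring)
  -- `ee ≥ 0`
  have Hee : ∀ z, 0 ≤ ee z := fun z =>
    integral_nonneg fun q => mul_nonneg (mul_nonneg (hkn _) (hkn _)) (hG4n _)
  -- ### the scaling relations
  have Hgs : g (3 / 2) = g (3 / 4) :=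
    noFastBlowDown_harm_scaling_energy U hU.continuous hdil hper k hk hk0 hk2 hk1
  have Hφs : φ (3 / 2) = (1 / 2 : ℝ) * φ (3 / 4) :=
    noFastBlowDown_harm_scaling_flux U hU hdil hper k hk hk0 hk2 hk1
  -- ### the monotone quantity `ψ = z φ - g`
  set ψ : ℝ → ℝ := fun z => z * φ z - g z with hψ
  have Hψ : ∀ z, 1 / 2 < z → z < 2 → HasDerivAt ψ (z * ee z) z := by
    intro z hz1 hz2
    have h := ((hasDerivAt_id z).mul (Hφ z)).sub (Hg z)
    refine h.congr_deriv ?_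
    rw [Hde z hz1 hz2]
    simp only [id]
    ring
  have Hψeq : ψ (3 / 2) = ψ (3 / 4) := by
    simp only [hψ]
    rw [Hgs, Hφs]
    ring
  have Hmono : MonotoneOn ψ (Icc (3 / 4 : ℝ) (3 / 2)) := by
    refine monotoneOn_of_hasDerivWithinAt_nonneg (convex_Icc _ _) ?_ ?_ ?_ (f' := fun z => z * ee z)
    · intro z hz
      exact (Hψ z (by linarith [hz.1]) (by linarith [hz.2])).continuousAt.continuousWithinAt
    · intro z hz
      rw [interior_Icc] at hz
      exact (Hψ z (by linarith [hz.1]) (by linarith [hz.2])).hasDerivWithinAt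
    · intro z hz
      rw [interior_Icc] at hz
      exact mul_nonneg (by linarith [hz.1]) (Hee z)
  -- `ψ` is constant on the open interval, hence `ee = 0` there
  have Hconst : ∀ z, 3 / 4 < z → z < 3 / 2 → ψ z = ψ (3 / 4) := by
    intro z hz1 hz2
    have h1 : ψ (3 / 4) ≤ ψ z :=
      Hmono ⟨le_rfl, by norm_num⟩ ⟨hz1.le, hz2.le⟩ hz1.le
    have h2 : ψ z ≤ ψ (3 / 2) :=
      Hmono ⟨hz1.le, hz2.le⟩ ⟨by norm_num, le_rfl⟩ hz2.le
    rw [Hψeq] at h2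
    exact le_antisymm h2 h1
  have Hee0 : ∀ z, 3 / 4 < z → z < 3 / 2 → ee z = 0 := by
    intro z hz1 hz2
    have hev : ψ =ᶠ[𝓝 z] fun _ => ψ (3 / 4) := by
      have hmem : Ioo (3 / 4 : ℝ) (3 / 2) ∈ 𝓝 z := isOpen_Ioo.mem_nhds ⟨hz1, hz2⟩
      filter_upwards [hmem] with w hw using Hconst w hw.1 hw.2
    have h0 : HasDerivAt ψ 0 z := (hasDerivAt_const z (ψ (3 / 4))).congr_of_eventuallyEq hev
    have huniq := (Hψ z (by linarith) (by linarith)).unique h0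
    rcases mul_eq_zero.1 huniq with h | h
    · linarith
    · exact h
  -- ### vanishing of the gradient on the open box
  have Hgrad : ∀ X : EuclideanSpace ℝ (Fin 3), 0 < X 0 → X 0 < 2 → 0 < X 1 → X 1 < 2 →
      3 / 4 < X 2 → X 2 < 3 / 2 → fderiv ℝ U X = 0 := by
    intro X h0a h0b h1a h1b h2a h2b
    have hXpt : X = !₂[X 0, X 1, X 2] := by
      ext i; fin_cases i <;> simp
    -- the nonnegative integrand of `ee (X 2)` vanishes at `(X 0, X 1)`
    have hvan := noFastBlowDown_cell_vanish k (fun q : ℝ × ℝ => G4 !₂[q.1, q.2, X 2]) hk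
      (by fun_prop) hk0 hk2 hkn (fun q => hG4n _) (Hee0 (X 2) h2a h2b) (X 0, X 1)
      (hkpos _ h0a h0b) (hkpos _ h1a h1b)
    simp only [hG4] at hvan
    rw [← hXpt] at hvan
    have hn : ∀ a b c : ℝ, 0 ≤ a → 0 ≤ b → 0 ≤ c → a + (b + c) = 0 → a = 0 ∧ b = 0 ∧ c = 0 :=
      fun a b c ha hb hc h => ⟨by linarith, by linarith, by linarith⟩
    obtain ⟨h2, h0, h1⟩ := hn _ _ _ (sq_nonneg _) (sq_nonneg _) (sq_nonneg _) hvan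
    refine noFastBlowDown_harmonic_clm_eq_zero _ fun i => ?_
    fin_cases i
    · simpa using h0
    · simpa using h1
    · simpa using h2
  -- ### `U` is constant on the box
  set B : Set (EuclideanSpace ℝ (Fin 3)) := {X | 0 < X 0 ∧ X 0 < 2 ∧ 0 < X 1 ∧ X 1 < 2 ∧
    3 / 4 < X 2 ∧ X 2 < 3 / 2} with hB
  have hBc : Convex ℝ B := noFastBlowDown_harmonic_box_convex
  have hBo : IsOpen B := noFastBlowDown_harmonic_box_isOpen
  have hUd : DifferentiableOn ℝ U B := (hU1.differentiable one_ne_zero).differentiableOn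
  have HconstU : ∀ X ∈ B, ∀ Y ∈ B, U X = U Y := fun X hX Y hY =>
    hBc.is_const_of_fderivWithin_eq_zero hUd
      (fun Z hZ => by
        rw [fderivWithin_of_isOpen hBo hZ]
        exact Hgrad Z hZ.1 hZ.2.1 hZ.2.2.1 hZ.2.2.2.1 hZ.2.2.2.2.1 hZ.2.2.2.2.2) hX hY
  -- ### the trace on the unit square of `X₂ = 1` is constant
  set w : EuclideanSpace ℝ (Fin 3) := U !₂[(1 : ℝ), 1, 1] with hw
  have hmemB : ∀ a b : ℝ, 0 < a → a < 2 → 0 < b → b < 2 →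
      (!₂[a, b, (1 : ℝ)] : EuclideanSpace ℝ (Fin 3)) ∈ B := by
    intro a b ha1 ha2 hb1 hb2
    have h0 : (!₂[a, b, (1 : ℝ)] : EuclideanSpace ℝ (Fin 3)) 0 = a := by simp
    have h1 : (!₂[a, b, (1 : ℝ)] : EuclideanSpace ℝ (Fin 3)) 1 = b := by simp
    have h2 : (!₂[a, b, (1 : ℝ)] : EuclideanSpace ℝ (Fin 3)) 2 = 1 := by simp
    show 0 < (!₂[a, b, (1 : ℝ)] : EuclideanSpace ℝ (Fin 3)) 0 ∧
      (!₂[a, b, (1 : ℝ)] : EuclideanSpace ℝ (Fin 3)) 0 < 2 ∧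
      0 < (!₂[a, b, (1 : ℝ)] : EuclideanSpace ℝ (Fin 3)) 1 ∧
      (!₂[a, b, (1 : ℝ)] : EuclideanSpace ℝ (Fin 3)) 1 < 2 ∧
      3 / 4 < (!₂[a, b, (1 : ℝ)] : EuclideanSpace ℝ (Fin 3)) 2 ∧
      (!₂[a, b, (1 : ℝ)] : EuclideanSpace ℝ (Fin 3)) 2 < 3 / 2
    rw [h0, h1, h2]
    exact ⟨ha1, ha2, hb1, hb2, by norm_num, by norm_num⟩
  have hedge0 : ∀ b : ℝ, U !₂[(0 : ℝ), b, 1] = U !₂[(1 : ℝ), b, 1] := by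
    intro b
    have hz : (!₂[(0 : ℝ), b, 1] : EuclideanSpace ℝ (Fin 3)) 2 = 1 := by simp
    have h := (hper (!₂[(0 : ℝ), b, 1]) (by rw [hz]) (by rw [hz]; norm_num)).1
    rw [← h, ← one_smul ℝ (EuclideanSpace.single (0 : Fin 3) (1 : ℝ)),
      noFastBlowDown_harm_pt_add_zero, zero_add]
  have hedge1 : ∀ a : ℝ, U !₂[a, (0 : ℝ), 1] = U !₂[a, (1 : ℝ), 1] := by
    intro a
    have hz : (!₂[a, (0 : ℝ), 1] : EuclideanSpace ℝ (Fin 3)) 2 = 1 := by simp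
    have h := (hper (!₂[a, (0 : ℝ), 1]) (by rw [hz]) (by rw [hz]; norm_num)).2
    rw [← h, ← one_smul ℝ (EuclideanSpace.single (1 : Fin 3) (1 : ℝ)),
      noFastBlowDown_harm_pt_add_one, zero_add]
  have Htrace : ∀ q : ℝ × ℝ, q ∈ Set.Icc (0 : ℝ) 1 ×ˢ Set.Icc (0 : ℝ) 1 →
      U !₂[q.1, q.2, (1 : ℝ)] = w := by
    intro q hq
    rw [Set.mem_prod, Set.mem_Icc, Set.mem_Icc] at hq
    obtain ⟨⟨ha0, ha1⟩, ⟨hb0, hb1⟩⟩ := hq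
    -- move the edges `q.1 = 0`, `q.2 = 0` inside by periodicity
    obtain ⟨a', ha', haU⟩ : ∃ a' : ℝ, (0 < a' ∧ a' < 2) ∧
        U !₂[q.1, q.2, (1 : ℝ)] = U !₂[a', q.2, 1] := by
      rcases ha0.lt_or_eq with h | h
      · exact ⟨q.1, ⟨h, by linarith⟩, rfl⟩
      · exact ⟨1, ⟨one_pos, one_lt_two⟩, by rw [← h, hedge0]⟩
    obtain ⟨b', hb', hbU⟩ : ∃ b' : ℝ, (0 < b' ∧ b' < 2) ∧
        U !₂[a', q.2, (1 : ℝ)] = U !₂[a', b', 1] := by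
      rcases hb0.lt_or_eq with h | h
      · exact ⟨q.2, ⟨h, by linarith⟩, rfl⟩
      · exact ⟨1, ⟨one_pos, one_lt_two⟩, by rw [← h, hedge1]⟩
    rw [haU, hbU, hw]
    exact HconstU _ (hmemB a' b' ha'.1 ha'.2 hb'.1 hb'.2) _
      (hmemB 1 1 one_pos one_lt_two one_pos one_lt_two)
  -- ### zero mass flux kills the vertical component, hence the energy flux
  have hS : MeasurableSet (Set.Icc (0 : ℝ) 1 ×ˢ Set.Icc (0 : ℝ) 1) :=
    measurableSet_Icc.prod measurableSet_Icc
  have hvol : (volume : Measure (ℝ × ℝ)).real (Set.Icc (0 : ℝ) 1 ×ˢ Set.Icc (0 : ℝ) 1) = 1 := by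
    simp only [Measure.real]
    rw [Measure.volume_eq_prod, Measure.prod_prod, Real.volume_Icc]
    simp
  have hmass' : ∫ q in Set.Icc (0 : ℝ) 1 ×ˢ Set.Icc (0 : ℝ) 1, (w 2 : ℝ) =
      ∫ q in Set.Icc (0 : ℝ) 1 ×ˢ Set.Icc (0 : ℝ) 1, (U !₂[q.1, q.2, (1 : ℝ)]) 2 :=
    setIntegral_congr_fun hS fun q hq => by rw [Htrace q hq]
  rw [hmass, setIntegral_const, hvol, one_smul] at hmass'
  have hflux' : ∫ q in Set.Icc (0 : ℝ) 1 ×ˢ Set.Icc (0 : ℝ) 1,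
      (U !₂[q.1, q.2, (1 : ℝ)]) 2 * (‖U !₂[q.1, q.2, (1 : ℝ)]‖ ^ 2 / 2 + Q !₂[q.1, q.2, (1 : ℝ)]) =
      ∫ q in Set.Icc (0 : ℝ) 1 ×ˢ Set.Icc (0 : ℝ) 1, (0 : ℝ) :=
    setIntegral_congr_fun hS fun q hq => by simp only [Htrace q hq, hmass', zero_mul]
  rw [hflux', integral_zero] at hflux
  exact hflux.symm

/-! ## The registered stub -/

/-- **Registered stub `stub_noFastBlowDownHarmonic`** = `noFastBlowDown_harmonic_flux_zero`: a
smooth field with the dilation relation on `1/2 ≤ X₂ ≤ 1`, band periodicity on `1 ≤ X₂ ≤ 2`,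
harmonic on `1/2 < X₂ < 2` and zero mass flux through the unit square of `X₂ = 1` has zero energy
flux through it. [folklore] -/
theorem stub_noFastBlowDownHarmonic :
    ∀ (U : EuclideanSpace ℝ (Fin 3) → EuclideanSpace ℝ (Fin 3)) (Q : EuclideanSpace ℝ (Fin 3) → ℝ)
      (F : ℝ), ContDiff ℝ ((⊤ : ℕ∞) : WithTop ℕ∞) U →
      (∀ X : EuclideanSpace ℝ (Fin 3), 1 / 2 ≤ X 2 → X 2 ≤ 1 → U ((2 : ℝ) • X) = U X) →
      (∀ X : EuclideanSpace ℝ (Fin 3), 1 ≤ X 2 → X 2 ≤ 2 →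
        U (X + EuclideanSpace.single 0 (1 : ℝ)) = U X ∧
          U (X + EuclideanSpace.single 1 (1 : ℝ)) = U X) →
      (∀ X : EuclideanSpace ℝ (Fin 3), 1 / 2 < X 2 → X 2 < 2 →
        ∑ i : Fin 3, fderiv ℝ (fun Y => fderiv ℝ U Y (EuclideanSpace.single i (1 : ℝ))) X
          (EuclideanSpace.single i (1 : ℝ)) = 0) →
      (∫ q in Set.Icc (0 : ℝ) 1 ×ˢ Set.Icc (0 : ℝ) 1, (U !₂[q.1, q.2, (1 : ℝ)]) 2 = 0) →
      (∫ q in Set.Icc (0 : ℝ) 1 ×ˢ Set.Icc (0 : ℝ) 1,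
        (U !₂[q.1, q.2, (1 : ℝ)]) 2 * (‖U !₂[q.1, q.2, (1 : ℝ)]‖ ^ 2 / 2 + Q !₂[q.1, q.2, (1 : ℝ)]) =
          F) →
      F = 0 :=
  noFastBlowDown_harmonic_flux_zero

end Summit.AnomalousDissipation.AnomalousDissipation.Theorems

end
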